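import Summits.AtomisticToContinuum.HydrodynamicLimit.Theorems.InformationPercolationEngineChaosClosesEulerDock
import Summits.AtomisticToContinuum.HydrodynamicLimit.Theorems.InformationPercolationEngineChaosClosesEulerEntropyBalance
import Summits.AtomisticToContinuum.HydrodynamicLimit.Theorems.InformationPercolationEngineChaosClosesEulerDissipationRigidity
import Summits.AtomisticToContinuum.HydrodynamicLimit.Theorems.InformationPercolationEngineChaosClosesEulerLocalEquilibriumFromDissipation
import HarnessLib

/-!
# The KINETIC DOCK of the crux `InformationPercolationEngine.ChaosClosesEuler` (stmt-AtomisticToContinuum-15141): the crux reduced to inputs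

Line `empirical-h-theorem` (crux-strategist s2, led by `prover-line-stmt-AtomisticToContinuum-15141-c4-0` after the line `Sketch` completed),
skeleton `Cruxes/ChaosClosesEuler/Lines/empirical_h_theorem.lean`: with wave 11 landed — the windowed entropy balance
`ChaosClosesEulerEntropyBalance.stub_windowedEntropyBalance` (p166416, deterministic), dissipation rigidity
`ChaosClosesEulerDissipationRigidity.stub_dissipationRigidity` (p164687) and the assembly
`ChaosClosesEulerLocalEquilibriumFromDissipation.stub_localEquilibriumFromDissipation` (p169406) — POINTWISE LOCAL EQUILIBRIUM follows
from ONE new same-time chaos input, the pointwise entropic chaos (PEnC), plus the cubic one-body tails (stmt-9235) and the quartic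
collision tightness (stmt-13354); composed with the landed local-equilibrium dock `ChaosClosesEulerDock.stub_dock` (p157936) this
reduces the crux to SIX INPUTS, all of Boltzmann-hypothesis / board-item class and none provable inside the line:

    PointwiseEntropicChaos (PEnC, new) → PointwiseEnskogCollisions (PEC, new) → LimitCollisionMeasure.LocalSecondLaw (13352) →
    LimitCollisionMeasure.CollisionTightness (13354) → TwoClocks.EnergyCurrentTails (9235) → DensityCap (13082) → ChaosClosesEuler.

The two new inputs are carried as hypotheses with their bodies inlined VERBATIM from the skeleton defs (`PointwiseEntropicChaos`,
`PointwiseEnskogCollisions`), so that the planner's children discharge them by `fun h => h`; this theorem is the glue of the split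
`ChaosClosesEuler ⇐ {9235, 13354, 13352 verbatim re-asks, PEC, PEnC} + DensityCap` (`Cruxes/ChaosClosesEuler/SPLIT-AMENDMENT.md` v2).

References: L. Boltzmann (1872) (H-theorem); J. Březina, E. Feireisl, J. Math. Soc. Japan 70 (2018) (weak–strong uniqueness, Thm 2.5);
C. Cercignani, R. Illner, M. Pulvirenti (1994) §3.1–3.3.
-/

noncomputable section

namespace Summit.AtomisticToContinuum.HydrodynamicLimit.Theorems.ChaosClosesEulerKineticDock

open scoped BigOperators Topology Classical MeasureTheory ENNReal InnerProductSpace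
open Filter Set MeasureTheory
open Literature.MathematicalPhysics.KineticTheory
open Literature.Analysis.FluidPDE
open Summit.AtomisticToContinuum.HydrodynamicLimit.Theses
open Summit.AtomisticToContinuum.HydrodynamicLimit.Theses.InformationPercolationEngine

/-- **The kinetic dock**: pointwise entropic chaos (`hPEnC`), pointwise Enskog collision statistics (`hPEC`), the clamped local second
law (13352), quartic collision tightness (13354), cubic one-body tails (9235) and the fine-scale density cap (13082) imply the crux
`ChaosClosesEuler`.  Composition of landed theorems only: the windowed entropy balance, `hPEnC`, dissipation rigidity, 9235 and 13354 give
pointwise local equilibrium (assembly p169406), which the local-equilibrium dock (p157936) takes, with `hPEC`, 13352, 13354, 9235, 13082,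
to the crux. [cite: BrezinaFeireisl2018, Thm 2.5] -/
theorem chaosClosesEuler_of_entropicChaos
    (hPEnC : ∃ η₀ : ℝ, 0 < η₀ ∧ ∀ (a₀ θ₀ : T3 → ℝ) (u₀ : T3 → V3), Continuous a₀ → Continuous θ₀ → Continuous u₀ →
        (∀ x, 0 < a₀ x) → (∀ x, 0 < θ₀ x) → ∃ σ₀ : ℝ, 0 < σ₀ ∧ ∀ σ : ℝ, 0 < σ → σ < σ₀ →
        ∀ Φ : (N : ℕ) → HardSphereFlow (Torus.geometry (Fin 3)) (hsDiameter σ N) (N + 1),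
        ∀ τ : ℝ, 0 < τ → ∀ δ : ℝ, 0 < δ →
        ∀ h : ℝ → ℝ, Continuous h → (∃ C : ℝ, ∀ a, |h a| ≤ C) → (∀ a : ℝ, η₀ ≤ σ ^ 3 * a → h a = 0) →
        ∀ η δ' : ℝ, 0 < η → 0 < δ' → ∃ K₀ : ℝ, ∀ K : ℝ, K₀ ≤ K → ∃ L₀ : ℝ, ∀ L : ℝ, L₀ ≤ L →
        ∃ r₀ : ℝ, 0 < r₀ ∧ ∀ r : ℝ, 0 < r → r < r₀ → ∃ N₀ : ℕ, ∀ N : ℕ, N₀ ≤ N →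
        let ε := hsDiameter σ N
        let Gm : Geometry (Fin 3) T3 := Torus.geometry (Fin 3)
        let γ : Config (N + 1) (Fin 3) T3 → ℝ → Config (N + 1) (Fin 3) T3 := fun z s => (Φ N).flow s z
        let bx : T3 → T3 → ℝ := fun y x => 3 / (Real.pi * r ^ 3) * max (1 - Torus.euclidDist y x / r) 0
        let bt : ℝ → ℝ := fun a => r⁻¹ * max (1 - |a| / r) 0
        let ρm : Config (N + 1) (Fin 3) T3 → T3 → ℝ := fun w x => ∫ q, bx q.1 x ∂(empiricalMeasure w)
        let φδ : V3 → ℝ := fun v => localMaxwellian 1 (δ ^ 2) 0 v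
        let y₀ : V3 → ℝ := fun v => Real.exp (-K) * ((1 + ‖v‖ ^ 2) ^ 2)⁻¹
        let ℓK : V3 → ℝ → ℝ := fun v y => if y₀ v ≤ y then Real.log y else Real.log (y₀ v) + (y - y₀ v) / y₀ v
        let g : Config (N + 1) (Fin 3) T3 → T3 → V3 → ℝ := fun w x v =>
          ∫ q, bx q.1 x * φδ (v - q.2) ∂(empiricalMeasure w)
        let Λt : Config (N + 1) (Fin 3) T3 → T3 → V3 → ℝ := fun w x v => ∫ u, φδ (v - u) * ℓK u (g w x u)
        let Gt : Config (N + 1) (Fin 3) T3 → T3 → V3 → ℝ := fun w x v => Real.exp (Λt w x v)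
        let Θ : Config (N + 1) (Fin 3) T3 → T3 → V3 → V3 → ℝ := fun w x v u =>
          ∫ ω : Metric.sphere (0 : V3) 1,
            (Λt w x v - Λt w x (collide ω (v, u)).1) * hardSphereKernel (u, v) ω ∂sphereMeasure
        let cut : V3 → V3 → ℝ := fun v u => if ‖v‖ ^ 2 + ‖u‖ ^ 2 ≤ L then 1 else 0
        let Pred : Config (N + 1) (Fin 3) T3 → T3 → ℝ := fun w x =>
          ∫ v, ∫ u, cut v u * Θ w x v u * (Gt w x v * Gt w x u)
        let pv : Config (N + 1) (Fin 3) T3 → ℝ → Fin (N + 1) → Fin (N + 1) → V3 × V3 := fun z s i j =>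
          reflectVel (Gm.sepVec (γ z s i).1 (γ z s j).1) ((γ z s i).2, (γ z s j).2)
        let Y : ℝ → ℝ := fun a => 3 / (2 * Real.pi) * deriv hsExcessFreeEnergy a
        let Kr : Config (N + 1) (Fin 3) T3 → ℝ → T3 → ℝ := fun z t₀ x₀ =>
          ε / (N + 1 : ℝ) * ∑ᶠ (s : ℝ) (_ : s ∈ collisionTimes Gm ε (γ z) ∩ Set.Icc 0 τ),
            ∑ i : Fin (N + 1), ∑ j : Fin (N + 1),
              (if i ≠ j ∧ ‖Gm.sepVec (γ z s i).1 (γ z s j).1‖ = ε then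
                bt (s - t₀) * cut (pv z s i j).1 (pv z s i j).2 *
                  ∫ x, bx x x₀ * h (ρm (γ z s) x) * bx (γ z s i).1 x *
                    (Λt (γ z s) x (pv z s i j).1 - Λt (γ z s) x (γ z s i).2) else 0)
        let R : Config (N + 1) (Fin 3) T3 → ℝ → T3 → ℝ := fun z t₀ x₀ =>
          σ ^ 3 * ∫ s in Set.Icc 0 τ, bt (s - t₀) *
            ∫ x, bx x x₀ * (h (ρm (γ z s) x) * Y (σ ^ 3 * ρm (γ z s) x) * Pred (γ z s) x)
        localGibbsLaw σ a₀ u₀ θ₀ N (Φ N)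
          {z | η < ∫ t₀ in Set.Icc 0 τ, ∫ x₀, |Kr z t₀ x₀ - R z t₀ x₀|} ≤ ENNReal.ofReal δ')
    (hPEC : ∃ η₀ : ℝ, 0 < η₀ ∧ ∀ (a₀ θ₀ : T3 → ℝ) (u₀ : T3 → V3), Continuous a₀ → Continuous θ₀ → Continuous u₀ →
        (∀ x, 0 < a₀ x) → (∀ x, 0 < θ₀ x) → ∃ σ₀ : ℝ, 0 < σ₀ ∧ ∀ σ : ℝ, 0 < σ → σ < σ₀ →
        ∀ Φ : (N : ℕ) → HardSphereFlow (Torus.geometry (Fin 3)) (hsDiameter σ N) (N + 1),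
        ∀ τ : ℝ, 0 < τ → ∀ G : V3 × V3 × V3 → ℝ, Continuous G → (∃ C : ℝ, ∀ p, |G p| ≤ C) →
        ∀ h : ℝ × V3 × ℝ → ℝ, Continuous h → (∃ C : ℝ, ∀ p, |h p| ≤ C) →
        (∀ p : ℝ × V3 × ℝ, η₀ ≤ σ ^ 3 * p.1 → h p = 0) →
        ∀ η δ : ℝ, 0 < η → 0 < δ → ∃ r₀ : ℝ, 0 < r₀ ∧ ∀ r : ℝ, 0 < r → r < r₀ → ∃ N₀ : ℕ, ∀ N : ℕ, N₀ ≤ N →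
        let ε := hsDiameter σ N
        let Gm : Geometry (Fin 3) T3 := Torus.geometry (Fin 3)
        let γ : Config (N + 1) (Fin 3) T3 → ℝ → Config (N + 1) (Fin 3) T3 := fun z s => (Φ N).flow s z
        let bx : T3 → T3 → ℝ := fun y x => 3 / (Real.pi * r ^ 3) * max (1 - Torus.euclidDist y x / r) 0
        let bt : ℝ → ℝ := fun a => r⁻¹ * max (1 - |a| / r) 0
        let ρm : Config (N + 1) (Fin 3) T3 → T3 → ℝ := fun w x₀ => ∫ q, bx q.1 x₀ ∂(empiricalMeasure w)
        let mm : Config (N + 1) (Fin 3) T3 → T3 → V3 := fun w x₀ => ∫ q, bx q.1 x₀ • q.2 ∂(empiricalMeasure w)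
        let em : Config (N + 1) (Fin 3) T3 → T3 → ℝ := fun w x₀ =>
          ∫ q, bx q.1 x₀ * (‖q.2‖ ^ 2 / 2) ∂(empiricalMeasure w)
        let um : Config (N + 1) (Fin 3) T3 → T3 → V3 := fun w x₀ => (ρm w x₀)⁻¹ • mm w x₀
        let θm : Config (N + 1) (Fin 3) T3 → T3 → ℝ := fun w x₀ =>
          2 / 3 * (em w x₀ / ρm w x₀ - ‖mm w x₀‖ ^ 2 / (2 * ρm w x₀ ^ 2))
        let Hw : Config (N + 1) (Fin 3) T3 → T3 → ℝ := fun w x => h (ρm w x, um w x, θm w x)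
        let Θ : V3 → V3 → ℝ := fun v w =>
          ∫ ω : Metric.sphere (0 : V3) 1, G ((ω : V3), v, w) * hardSphereKernel (w, v) ω ∂sphereMeasure
        let BG : Config (N + 1) (Fin 3) T3 → T3 → ℝ := fun w x₀ =>
          ∫ p, bx p.1.1 x₀ * bx p.2.1 x₀ * Θ p.1.2 p.2.2 ∂((empiricalMeasure w).prod (empiricalMeasure w))
        let pv : Config (N + 1) (Fin 3) T3 → ℝ → Fin (N + 1) → Fin (N + 1) → V3 × V3 := fun z s i j =>
          reflectVel (Gm.sepVec (γ z s i).1 (γ z s j).1) ((γ z s i).2, (γ z s j).2)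
        let Y : ℝ → ℝ := fun a => 3 / (2 * Real.pi) * deriv hsExcessFreeEnergy a
        let Kr : Config (N + 1) (Fin 3) T3 → ℝ → T3 → ℝ := fun z t₀ x₀ =>
          ε / (N + 1 : ℝ) * ∑ᶠ (s : ℝ) (_ : s ∈ collisionTimes Gm ε (γ z) ∩ Set.Icc 0 τ),
            ∑ i : Fin (N + 1), ∑ j : Fin (N + 1),
              (if i ≠ j ∧ ‖Gm.sepVec (γ z s i).1 (γ z s j).1‖ = ε then
                bt (s - t₀) * bx (γ z s i).1 x₀ * Hw (γ z s) (γ z s i).1 *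
                  G (ε⁻¹ • Gm.sepVec (γ z s i).1 (γ z s j).1, (pv z s i j).1, (pv z s i j).2) else 0)
        let R : Config (N + 1) (Fin 3) T3 → ℝ → T3 → ℝ := fun z t₀ x₀ =>
          σ ^ 3 * ∫ s in Set.Icc 0 τ, bt (s - t₀) *
            ∫ x, bx x x₀ * (Hw (γ z s) x * Y (σ ^ 3 * ρm (γ z s) x) * BG (γ z s) x)
        localGibbsLaw σ a₀ u₀ θ₀ N (Φ N)
          {z | η < ∫ t₀ in Set.Icc 0 τ, ∫ x₀, |Kr z t₀ x₀ - R z t₀ x₀|} ≤ ENNReal.ofReal δ)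
    (hLSLc : LimitCollisionMeasure.LocalSecondLaw) (hCT : LimitCollisionMeasure.CollisionTightness)
    (hT : TwoClocks.EnergyCurrentTails) (hDC : DensityCap) : ChaosClosesEuler :=
  Summit.AtomisticToContinuum.HydrodynamicLimit.Theorems.ChaosClosesEulerDock.stub_dock
    (Summit.AtomisticToContinuum.HydrodynamicLimit.Theorems.ChaosClosesEulerLocalEquilibriumFromDissipation.stub_localEquilibriumFromDissipation
      Summit.AtomisticToContinuum.HydrodynamicLimit.Theorems.ChaosClosesEulerEntropyBalance.stub_windowedEntropyBalance hPEnC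
      Summit.AtomisticToContinuum.HydrodynamicLimit.Theorems.ChaosClosesEulerDissipationRigidity.stub_dissipationRigidity hT hCT)
    hPEC hLSLc hCT hT hDC

/-- **Registered form of the kinetic dock** (stub `stub_kineticDock` of stmt-AtomisticToContinuum-15141; arrow-shaped restatement of
`chaosClosesEuler_of_entropicChaos`): PEnC → PEC → 13352 → 13354 → 9235 → 13082 → `ChaosClosesEuler`. [cite: BrezinaFeireisl2018, Thm 2.5] -/
theorem stub_kineticDock :
    (∃ η₀ : ℝ, 0 < η₀ ∧ ∀ (a₀ θ₀ : T3 → ℝ) (u₀ : T3 → V3), Continuous a₀ → Continuous θ₀ → Continuous u₀ →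
        (∀ x, 0 < a₀ x) → (∀ x, 0 < θ₀ x) → ∃ σ₀ : ℝ, 0 < σ₀ ∧ ∀ σ : ℝ, 0 < σ → σ < σ₀ →
        ∀ Φ : (N : ℕ) → HardSphereFlow (Torus.geometry (Fin 3)) (hsDiameter σ N) (N + 1),
        ∀ τ : ℝ, 0 < τ → ∀ δ : ℝ, 0 < δ →
        ∀ h : ℝ → ℝ, Continuous h → (∃ C : ℝ, ∀ a, |h a| ≤ C) → (∀ a : ℝ, η₀ ≤ σ ^ 3 * a → h a = 0) →
        ∀ η δ' : ℝ, 0 < η → 0 < δ' → ∃ K₀ : ℝ, ∀ K : ℝ, K₀ ≤ K → ∃ L₀ : ℝ, ∀ L : ℝ, L₀ ≤ L →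
        ∃ r₀ : ℝ, 0 < r₀ ∧ ∀ r : ℝ, 0 < r → r < r₀ → ∃ N₀ : ℕ, ∀ N : ℕ, N₀ ≤ N →
        let ε := hsDiameter σ N
        let Gm : Geometry (Fin 3) T3 := Torus.geometry (Fin 3)
        let γ : Config (N + 1) (Fin 3) T3 → ℝ → Config (N + 1) (Fin 3) T3 := fun z s => (Φ N).flow s z
        let bx : T3 → T3 → ℝ := fun y x => 3 / (Real.pi * r ^ 3) * max (1 - Torus.euclidDist y x / r) 0
        let bt : ℝ → ℝ := fun a => r⁻¹ * max (1 - |a| / r) 0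
        let ρm : Config (N + 1) (Fin 3) T3 → T3 → ℝ := fun w x => ∫ q, bx q.1 x ∂(empiricalMeasure w)
        let φδ : V3 → ℝ := fun v => localMaxwellian 1 (δ ^ 2) 0 v
        let y₀ : V3 → ℝ := fun v => Real.exp (-K) * ((1 + ‖v‖ ^ 2) ^ 2)⁻¹
        let ℓK : V3 → ℝ → ℝ := fun v y => if y₀ v ≤ y then Real.log y else Real.log (y₀ v) + (y - y₀ v) / y₀ v
        let g : Config (N + 1) (Fin 3) T3 → T3 → V3 → ℝ := fun w x v =>
          ∫ q, bx q.1 x * φδ (v - q.2) ∂(empiricalMeasure w)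
        let Λt : Config (N + 1) (Fin 3) T3 → T3 → V3 → ℝ := fun w x v => ∫ u, φδ (v - u) * ℓK u (g w x u)
        let Gt : Config (N + 1) (Fin 3) T3 → T3 → V3 → ℝ := fun w x v => Real.exp (Λt w x v)
        let Θ : Config (N + 1) (Fin 3) T3 → T3 → V3 → V3 → ℝ := fun w x v u =>
          ∫ ω : Metric.sphere (0 : V3) 1,
            (Λt w x v - Λt w x (collide ω (v, u)).1) * hardSphereKernel (u, v) ω ∂sphereMeasure
        let cut : V3 → V3 → ℝ := fun v u => if ‖v‖ ^ 2 + ‖u‖ ^ 2 ≤ L then 1 else 0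
        let Pred : Config (N + 1) (Fin 3) T3 → T3 → ℝ := fun w x =>
          ∫ v, ∫ u, cut v u * Θ w x v u * (Gt w x v * Gt w x u)
        let pv : Config (N + 1) (Fin 3) T3 → ℝ → Fin (N + 1) → Fin (N + 1) → V3 × V3 := fun z s i j =>
          reflectVel (Gm.sepVec (γ z s i).1 (γ z s j).1) ((γ z s i).2, (γ z s j).2)
        let Y : ℝ → ℝ := fun a => 3 / (2 * Real.pi) * deriv hsExcessFreeEnergy a
        let Kr : Config (N + 1) (Fin 3) T3 → ℝ → T3 → ℝ := fun z t₀ x₀ =>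
          ε / (N + 1 : ℝ) * ∑ᶠ (s : ℝ) (_ : s ∈ collisionTimes Gm ε (γ z) ∩ Set.Icc 0 τ),
            ∑ i : Fin (N + 1), ∑ j : Fin (N + 1),
              (if i ≠ j ∧ ‖Gm.sepVec (γ z s i).1 (γ z s j).1‖ = ε then
                bt (s - t₀) * cut (pv z s i j).1 (pv z s i j).2 *
                  ∫ x, bx x x₀ * h (ρm (γ z s) x) * bx (γ z s i).1 x *
                    (Λt (γ z s) x (pv z s i j).1 - Λt (γ z s) x (γ z s i).2) else 0)
        let R : Config (N + 1) (Fin 3) T3 → ℝ → T3 → ℝ := fun z t₀ x₀ =>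
          σ ^ 3 * ∫ s in Set.Icc 0 τ, bt (s - t₀) *
            ∫ x, bx x x₀ * (h (ρm (γ z s) x) * Y (σ ^ 3 * ρm (γ z s) x) * Pred (γ z s) x)
        localGibbsLaw σ a₀ u₀ θ₀ N (Φ N)
          {z | η < ∫ t₀ in Set.Icc 0 τ, ∫ x₀, |Kr z t₀ x₀ - R z t₀ x₀|} ≤ ENNReal.ofReal δ') →
    (∃ η₀ : ℝ, 0 < η₀ ∧ ∀ (a₀ θ₀ : T3 → ℝ) (u₀ : T3 → V3), Continuous a₀ → Continuous θ₀ → Continuous u₀ →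
        (∀ x, 0 < a₀ x) → (∀ x, 0 < θ₀ x) → ∃ σ₀ : ℝ, 0 < σ₀ ∧ ∀ σ : ℝ, 0 < σ → σ < σ₀ →
        ∀ Φ : (N : ℕ) → HardSphereFlow (Torus.geometry (Fin 3)) (hsDiameter σ N) (N + 1),
        ∀ τ : ℝ, 0 < τ → ∀ G : V3 × V3 × V3 → ℝ, Continuous G → (∃ C : ℝ, ∀ p, |G p| ≤ C) →
        ∀ h : ℝ × V3 × ℝ → ℝ, Continuous h → (∃ C : ℝ, ∀ p, |h p| ≤ C) →
        (∀ p : ℝ × V3 × ℝ, η₀ ≤ σ ^ 3 * p.1 → h p = 0) →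
        ∀ η δ : ℝ, 0 < η → 0 < δ → ∃ r₀ : ℝ, 0 < r₀ ∧ ∀ r : ℝ, 0 < r → r < r₀ → ∃ N₀ : ℕ, ∀ N : ℕ, N₀ ≤ N →
        let ε := hsDiameter σ N
        let Gm : Geometry (Fin 3) T3 := Torus.geometry (Fin 3)
        let γ : Config (N + 1) (Fin 3) T3 → ℝ → Config (N + 1) (Fin 3) T3 := fun z s => (Φ N).flow s z
        let bx : T3 → T3 → ℝ := fun y x => 3 / (Real.pi * r ^ 3) * max (1 - Torus.euclidDist y x / r) 0
        let bt : ℝ → ℝ := fun a => r⁻¹ * max (1 - |a| / r) 0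
        let ρm : Config (N + 1) (Fin 3) T3 → T3 → ℝ := fun w x₀ => ∫ q, bx q.1 x₀ ∂(empiricalMeasure w)
        let mm : Config (N + 1) (Fin 3) T3 → T3 → V3 := fun w x₀ => ∫ q, bx q.1 x₀ • q.2 ∂(empiricalMeasure w)
        let em : Config (N + 1) (Fin 3) T3 → T3 → ℝ := fun w x₀ =>
          ∫ q, bx q.1 x₀ * (‖q.2‖ ^ 2 / 2) ∂(empiricalMeasure w)
        let um : Config (N + 1) (Fin 3) T3 → T3 → V3 := fun w x₀ => (ρm w x₀)⁻¹ • mm w x₀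
        let θm : Config (N + 1) (Fin 3) T3 → T3 → ℝ := fun w x₀ =>
          2 / 3 * (em w x₀ / ρm w x₀ - ‖mm w x₀‖ ^ 2 / (2 * ρm w x₀ ^ 2))
        let Hw : Config (N + 1) (Fin 3) T3 → T3 → ℝ := fun w x => h (ρm w x, um w x, θm w x)
        let Θ : V3 → V3 → ℝ := fun v w =>
          ∫ ω : Metric.sphere (0 : V3) 1, G ((ω : V3), v, w) * hardSphereKernel (w, v) ω ∂sphereMeasure
        let BG : Config (N + 1) (Fin 3) T3 → T3 → ℝ := fun w x₀ =>
          ∫ p, bx p.1.1 x₀ * bx p.2.1 x₀ * Θ p.1.2 p.2.2 ∂((empiricalMeasure w).prod (empiricalMeasure w))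
        let pv : Config (N + 1) (Fin 3) T3 → ℝ → Fin (N + 1) → Fin (N + 1) → V3 × V3 := fun z s i j =>
          reflectVel (Gm.sepVec (γ z s i).1 (γ z s j).1) ((γ z s i).2, (γ z s j).2)
        let Y : ℝ → ℝ := fun a => 3 / (2 * Real.pi) * deriv hsExcessFreeEnergy a
        let Kr : Config (N + 1) (Fin 3) T3 → ℝ → T3 → ℝ := fun z t₀ x₀ =>
          ε / (N + 1 : ℝ) * ∑ᶠ (s : ℝ) (_ : s ∈ collisionTimes Gm ε (γ z) ∩ Set.Icc 0 τ),
            ∑ i : Fin (N + 1), ∑ j : Fin (N + 1),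
              (if i ≠ j ∧ ‖Gm.sepVec (γ z s i).1 (γ z s j).1‖ = ε then
                bt (s - t₀) * bx (γ z s i).1 x₀ * Hw (γ z s) (γ z s i).1 *
                  G (ε⁻¹ • Gm.sepVec (γ z s i).1 (γ z s j).1, (pv z s i j).1, (pv z s i j).2) else 0)
        let R : Config (N + 1) (Fin 3) T3 → ℝ → T3 → ℝ := fun z t₀ x₀ =>
          σ ^ 3 * ∫ s in Set.Icc 0 τ, bt (s - t₀) *
            ∫ x, bx x x₀ * (Hw (γ z s) x * Y (σ ^ 3 * ρm (γ z s) x) * BG (γ z s) x)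
        localGibbsLaw σ a₀ u₀ θ₀ N (Φ N)
          {z | η < ∫ t₀ in Set.Icc 0 τ, ∫ x₀, |Kr z t₀ x₀ - R z t₀ x₀|} ≤ ENNReal.ofReal δ) →
    LimitCollisionMeasure.LocalSecondLaw → LimitCollisionMeasure.CollisionTightness →
    TwoClocks.EnergyCurrentTails → DensityCap → ChaosClosesEuler :=
  fun hPEnC hPEC hLSLc hCT hT hDC => chaosClosesEuler_of_entropicChaos hPEnC hPEC hLSLc hCT hT hDC

/-- **Pointwise local equilibrium from pointwise entropic chaos** (the kinetic sub-line of `empirical-h-theorem` on its own, for a planner who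
files `KineticLocalEquilibrium` as an item: its glue): PEnC, the cubic one-body tails (9235) and the quartic collision tightness (13354) imply
pointwise local equilibrium at scale `r` in band — the windowed entropy balance (p166416) and dissipation rigidity (p164687) fed to the assembly
(p169406). [cite: CIP1994, §3.2] -/
theorem pointwiseLocalEquilibrium_of_entropicChaos
    (hPEnC : ∃ η₀ : ℝ, 0 < η₀ ∧ ∀ (a₀ θ₀ : T3 → ℝ) (u₀ : T3 → V3), Continuous a₀ → Continuous θ₀ → Continuous u₀ →
        (∀ x, 0 < a₀ x) → (∀ x, 0 < θ₀ x) → ∃ σ₀ : ℝ, 0 < σ₀ ∧ ∀ σ : ℝ, 0 < σ → σ < σ₀ →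
        ∀ Φ : (N : ℕ) → HardSphereFlow (Torus.geometry (Fin 3)) (hsDiameter σ N) (N + 1),
        ∀ τ : ℝ, 0 < τ → ∀ δ : ℝ, 0 < δ →
        ∀ h : ℝ → ℝ, Continuous h → (∃ C : ℝ, ∀ a, |h a| ≤ C) → (∀ a : ℝ, η₀ ≤ σ ^ 3 * a → h a = 0) →
        ∀ η δ' : ℝ, 0 < η → 0 < δ' → ∃ K₀ : ℝ, ∀ K : ℝ, K₀ ≤ K → ∃ L₀ : ℝ, ∀ L : ℝ, L₀ ≤ L →
        ∃ r₀ : ℝ, 0 < r₀ ∧ ∀ r : ℝ, 0 < r → r < r₀ → ∃ N₀ : ℕ, ∀ N : ℕ, N₀ ≤ N →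
        let ε := hsDiameter σ N
        let Gm : Geometry (Fin 3) T3 := Torus.geometry (Fin 3)
        let γ : Config (N + 1) (Fin 3) T3 → ℝ → Config (N + 1) (Fin 3) T3 := fun z s => (Φ N).flow s z
        let bx : T3 → T3 → ℝ := fun y x => 3 / (Real.pi * r ^ 3) * max (1 - Torus.euclidDist y x / r) 0
        let bt : ℝ → ℝ := fun a => r⁻¹ * max (1 - |a| / r) 0
        let ρm : Config (N + 1) (Fin 3) T3 → T3 → ℝ := fun w x => ∫ q, bx q.1 x ∂(empiricalMeasure w)
        let φδ : V3 → ℝ := fun v => localMaxwellian 1 (δ ^ 2) 0 v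
        let y₀ : V3 → ℝ := fun v => Real.exp (-K) * ((1 + ‖v‖ ^ 2) ^ 2)⁻¹
        let ℓK : V3 → ℝ → ℝ := fun v y => if y₀ v ≤ y then Real.log y else Real.log (y₀ v) + (y - y₀ v) / y₀ v
        let g : Config (N + 1) (Fin 3) T3 → T3 → V3 → ℝ := fun w x v =>
          ∫ q, bx q.1 x * φδ (v - q.2) ∂(empiricalMeasure w)
        let Λt : Config (N + 1) (Fin 3) T3 → T3 → V3 → ℝ := fun w x v => ∫ u, φδ (v - u) * ℓK u (g w x u)
        let Gt : Config (N + 1) (Fin 3) T3 → T3 → V3 → ℝ := fun w x v => Real.exp (Λt w x v)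
        let Θ : Config (N + 1) (Fin 3) T3 → T3 → V3 → V3 → ℝ := fun w x v u =>
          ∫ ω : Metric.sphere (0 : V3) 1,
            (Λt w x v - Λt w x (collide ω (v, u)).1) * hardSphereKernel (u, v) ω ∂sphereMeasure
        let cut : V3 → V3 → ℝ := fun v u => if ‖v‖ ^ 2 + ‖u‖ ^ 2 ≤ L then 1 else 0
        let Pred : Config (N + 1) (Fin 3) T3 → T3 → ℝ := fun w x =>
          ∫ v, ∫ u, cut v u * Θ w x v u * (Gt w x v * Gt w x u)
        let pv : Config (N + 1) (Fin 3) T3 → ℝ → Fin (N + 1) → Fin (N + 1) → V3 × V3 := fun z s i j =>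
          reflectVel (Gm.sepVec (γ z s i).1 (γ z s j).1) ((γ z s i).2, (γ z s j).2)
        let Y : ℝ → ℝ := fun a => 3 / (2 * Real.pi) * deriv hsExcessFreeEnergy a
        let Kr : Config (N + 1) (Fin 3) T3 → ℝ → T3 → ℝ := fun z t₀ x₀ =>
          ε / (N + 1 : ℝ) * ∑ᶠ (s : ℝ) (_ : s ∈ collisionTimes Gm ε (γ z) ∩ Set.Icc 0 τ),
            ∑ i : Fin (N + 1), ∑ j : Fin (N + 1),
              (if i ≠ j ∧ ‖Gm.sepVec (γ z s i).1 (γ z s j).1‖ = ε then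
                bt (s - t₀) * cut (pv z s i j).1 (pv z s i j).2 *
                  ∫ x, bx x x₀ * h (ρm (γ z s) x) * bx (γ z s i).1 x *
                    (Λt (γ z s) x (pv z s i j).1 - Λt (γ z s) x (γ z s i).2) else 0)
        let R : Config (N + 1) (Fin 3) T3 → ℝ → T3 → ℝ := fun z t₀ x₀ =>
          σ ^ 3 * ∫ s in Set.Icc 0 τ, bt (s - t₀) *
            ∫ x, bx x x₀ * (h (ρm (γ z s) x) * Y (σ ^ 3 * ρm (γ z s) x) * Pred (γ z s) x)
        localGibbsLaw σ a₀ u₀ θ₀ N (Φ N)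
          {z | η < ∫ t₀ in Set.Icc 0 τ, ∫ x₀, |Kr z t₀ x₀ - R z t₀ x₀|} ≤ ENNReal.ofReal δ')
    (hT : TwoClocks.EnergyCurrentTails) (hCT : LimitCollisionMeasure.CollisionTightness) :
    ∃ η₀ : ℝ, 0 < η₀ ∧ ∀ (a₀ θ₀ : T3 → ℝ) (u₀ : T3 → V3), Continuous a₀ → Continuous θ₀ → Continuous u₀ →
      (∀ x, 0 < a₀ x) → (∀ x, 0 < θ₀ x) → ∃ σ₀ : ℝ, 0 < σ₀ ∧ ∀ σ : ℝ, 0 < σ → σ < σ₀ →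
      ∀ (T : ℝ) (ρ θ : ℝ → T3 → ℝ) (u : ℝ → T3 → V3), IsHardSphereEulerSolution σ T ρ u θ →
      ∀ Φ : (N : ℕ) → HardSphereFlow (Torus.geometry (Fin 3)) (hsDiameter σ N) (N + 1),
      TendstoHydroFieldsAt (fun N => localGibbsLaw σ a₀ u₀ θ₀ N (Φ N)) Φ ρ u θ 0 →
      ∀ t ∈ Set.Ico 0 T, ∀ ψ : V3 → ℝ, Continuous ψ → (∃ C : ℝ, ∀ v, |ψ v| ≤ C) →
      ∀ h : ℝ × V3 × ℝ → ℝ, Continuous h → (∃ C : ℝ, ∀ p, |h p| ≤ C) →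
      (∃ ρ₁ θ₁ Θ U : ℝ, 0 < ρ₁ ∧ 0 < θ₁ ∧ ∀ p : ℝ × V3 × ℝ,
        (p.1 ≤ ρ₁ ∨ η₀ ≤ σ ^ 3 * p.1 ∨ p.2.2 ≤ θ₁ ∨ Θ ≤ p.2.2 ∨ U ≤ ‖p.2.1‖) → h p = 0) →
      ∀ η δ : ℝ, 0 < η → 0 < δ → ∃ r₀ : ℝ, 0 < r₀ ∧ ∀ r : ℝ, 0 < r → r < r₀ → ∃ N₀ : ℕ, ∀ N : ℕ, N₀ ≤ N →
      let bx : T3 → T3 → ℝ := fun y x => 3 / (Real.pi * r ^ 3) * max (1 - Torus.euclidDist y x / r) 0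
      let ρm : Config (N + 1) (Fin 3) T3 → T3 → ℝ := fun w x₀ => ∫ q, bx q.1 x₀ ∂(empiricalMeasure w)
      let mm : Config (N + 1) (Fin 3) T3 → T3 → V3 := fun w x₀ => ∫ q, bx q.1 x₀ • q.2 ∂(empiricalMeasure w)
      let em : Config (N + 1) (Fin 3) T3 → T3 → ℝ := fun w x₀ =>
        ∫ q, bx q.1 x₀ * (‖q.2‖ ^ 2 / 2) ∂(empiricalMeasure w)
      let um : Config (N + 1) (Fin 3) T3 → T3 → V3 := fun w x₀ => (ρm w x₀)⁻¹ • mm w x₀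
      let θm : Config (N + 1) (Fin 3) T3 → T3 → ℝ := fun w x₀ =>
        2 / 3 * (em w x₀ / ρm w x₀ - ‖mm w x₀‖ ^ 2 / (2 * ρm w x₀ ^ 2))
      let Mψ : Config (N + 1) (Fin 3) T3 → T3 → ℝ := fun w x₀ => ∫ q, bx q.1 x₀ * ψ q.2 ∂(empiricalMeasure w)
      localGibbsLaw σ a₀ u₀ θ₀ N (Φ N)
        {z | η < ∫ s in Set.Icc 0 t, ∫ x,
          |h (ρm ((Φ N).flow s z) x, um ((Φ N).flow s z) x, θm ((Φ N).flow s z) x)| *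
            |Mψ ((Φ N).flow s z) x - ρm ((Φ N).flow s z) x *
              ∫ v, ψ v * localMaxwellian 1 (θm ((Φ N).flow s z) x) (um ((Φ N).flow s z) x) v|} ≤ ENNReal.ofReal δ :=
  Summit.AtomisticToContinuum.HydrodynamicLimit.Theorems.ChaosClosesEulerLocalEquilibriumFromDissipation.stub_localEquilibriumFromDissipation
    Summit.AtomisticToContinuum.HydrodynamicLimit.Theorems.ChaosClosesEulerEntropyBalance.stub_windowedEntropyBalance hPEnC
    Summit.AtomisticToContinuum.HydrodynamicLimit.Theorems.ChaosClosesEulerDissipationRigidity.stub_dissipationRigidity hT hCT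

/-- Bookkeeping anchor `stub_kineticDockAnchor` for the gate's `--supports` matching (the kinetic dock's inlined signature exceeds the
registry's 4000 characters): the TWO-LEVEL logical shape of the kinetic dock (kinetic sub-line `PEnC → 9235 → 13354 → PLE` composed with the local-equilibrium dock
`PLE → PEC → 13352 → 13354 → 9235 → 13082 → Crux`) in the split's glue order
`EnergyCurrentTails → CollisionTightness → LocalSecondLawClamped → PointwiseEnskogCollisions → PointwiseEntropicChaos → DensityCap → ChaosClosesEuler`
(same device as, and distinct from, `ChaosClosesEulerDock.stub_dockAnchor`). [folklore] -/
theorem stub_kineticDockAnchor :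
    ∀ (PEnC PEC LSL CT ECT DC PLE Crux : Prop),
      (PEnC → ECT → CT → PLE) → (PLE → PEC → LSL → CT → ECT → DC → Crux) →
        ECT → CT → LSL → PEC → PEnC → DC → Crux :=
  fun _ _ _ _ _ _ _ _ hkin hdock hT hCT hL hPEC hPEnC hDC => hdock (hkin hPEnC hT hCT) hPEC hL hCT hT hDC

end Summit.AtomisticToContinuum.HydrodynamicLimit.Theorems.ChaosClosesEulerKineticDock

end
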